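import Summits.AtomisticToContinuum.HydrodynamicLimit.Theorems.CollisionIsometryCLTAdaptedWeightCLTSustainedAnisotropyB
import Summits.AtomisticToContinuum.HydrodynamicLimit.Theorems.CollisionIsometryCLTDiffuseBackwardInfluenceEntropyTransfer

/-!
# Skeleton of the ALTERNATIVE line `kinetic-cell-epoch-ld` for the crux `AdaptedWeightCLT`
(stmt-AtomisticToContinuum-14868, rev-12 TIME-LOCAL form; route `CollisionIsometryCLT`, sub-problem `HydrodynamicLimit`;
crux-strategist seat `planner-cstrat-stmt-AtomisticToContinuum-14868-s1-0`, 2026-08-17; card `Lines/kinetic-cell-epoch-ld.md`).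
Registered with `--alt`: it does NOT replace the lead's live skeleton `Lines/sustained_anisotropy_superexp.lean`; it re-uses that
line's LANDED vocabulary (`…Theorems.SustainedAnisotropy`: `cvel`, `cellA`, `ethC`, `reyC`, `CellInt`, `ReynInt`, `CellUIBound`)
and its proved transfer pattern, and changes exactly the HARDEST step.

THE LINE. Same scale split of the crux functional `X = ∫₀ᵗ∫ₓ DefectSq` as the live line, but with KINETIC cells of FIXED particle
content `m` (`(N+1) ℓ_N³ = m`, i.e. cells of `≍ (m σ⁶)^{1/3}` mean free paths — an `N`-INDEPENDENT kinetic size, chosen after the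
threshold `κ` so that the thermal floors `≍ θ/m` of the cell functionals sit below `κ`), and a different equilibrium input:

* `stub_scaleSplitK` (M): the live line's pointwise split `defectC ≤ 2·cellA + K·ethC·reyC` for cell kernels of fixed content
  (the algebra never uses `m_cell → ∞`), hence `P{δ < X} ≤ P{δ/K < CellInt} + P{δ/K < ReynInt}` eventually.
* `stub_reynoldsK` (L; DECLARED EXPOSURE, MesoQuiescence-class, now down to a fixed multiple of the mean free path): for every
  `κ > 0` there is a content `m₁(κ)` such that for cells of content `m ≥ m₁` the energy-weighted sub-block fluctuation of the
  cell velocities has `P{κ < ReynInt} → 0` (`∀ t > 0`; H1, H2 available as hypotheses).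
* `stub_cellsK` (M): kinetic cell kernels of every content `m ≥ 1` EXIST and satisfy the uniform-integrability bound
  `CellUIBound` of the live line (covering/packing: a cell of `(mσ⁻³)^{1/3}` diameters holds `O(1 + m/σ³)` spheres).
* `stub_epochLD` (XL; HARDEST, but on the LANFORD TIME SCALE): under the invariant homogeneous Gibbs law `G_N`, for every level
  `a` (content `m ≥ m₁(a)`), every tail clamp and EVERY rate `c` there are `m₀ = m₀(c)` epochs and a gap `τ₀` such that for
  every span `T₀` — `τ₀, T₀` counted in the kinetic time unit `ktu N = (N+1)^{-1/3}` (the mean free time up to `σ, θ` factors),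
  `m₀, τ₀, T₀` all `N`-INDEPENDENT — eventually in `N`, for every `m₀`-tuple of times with gaps `≥ τ₀·ktu` inside a span
  `≤ T₀·ktu`, the event "the configuration has spatial cell anisotropy `∫ₓ cellA ≥ a` and exponential moment `≤ Cw` at EACH of
  the `m₀` times" has `G_N`-probability `≤ e^{-c(N+1)}`. The dynamics is asked for an exponential (not super-exponential)
  large-deviation bound over a FIXED number of mean free times: each further epoch of sustained kinetic anisotropy costs
  `≥ c₁(a)·N` more (kinetic relaxation at LD level; sub-cell shear lives only `≍ σ⁴ m^{2/3}` mean free times — `N`-independent —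
  and is priced by the gap `τ₀`; pinned / idle / cradle scenarios cost `≥ 3(N+1)·log(#epochs)`, cf. the 13733 cradle witness;
  well-separated epochs are independent fluctuations, rate `m₀·I(a)`).
* `stub_gridToHorizon` (M/L; measure theory + pigeonhole): the transferred tuple bounds (`P_N ≤ e^{-(N+1)}` per tuple, from the
  landed setwise domination `P_N ≤ e^{Cd(N+1)} G_N` at `c = Cd + 2`, proved in the composition) and H2 give `P{κ < CellInt} → 0`:
  `CellInt ≤ a·t + (UI bound) × |{s ≤ t : Φ_s z anisotropic ∧ tails ≤ Cw}| + (UI bound) × C_exp/Cw`; a random shift of the grid of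
  mesh `τ₀·ktu` on `[0,t]` plus pigeonhole turns "time fraction `≥ η`" into "some `m₀` grid times among `⌈2m₀/η⌉` consecutive
  ones are anisotropic", a union over `O(t (N+1)^{1/3})` events of probability `≤ e^{-(N+1)}` each.

SUPER-EXPONENTIALITY IS MANUFACTURED BY BOOKKEEPING (the macroscopic horizon contains `ν_N ≍ (N+1)^{1/3} → ∞` kinetic epochs), NOT
ASKED OF THE DYNAMICS — this is the delta to the live line, whose `stub_superExp` needs an `e^{-ω(N)}` bound over `K_N → ∞`
collision times with the binders `K_N ≫ L_N²` (LD-level viscous damping of sub-cell shear) and `K_N ≫ m_cell`.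
H1 (`DiffuseAt`) is NOT used by this line (fixed kinetic epochs are not admissible windows): if it closes, it proves the
`WithoutDiffuse` shape of `Cruxes/AdaptedWeightCLT/Disproof.lean` §1b.

The composition (`lineCloses : LineCloses`, the five statements `→` the crux; `AdaptedWeightCLT_of_stubs` concludes the crux BY
NAME) is PROVED below; the only `sorry`s are the five `stub_*`.
-/

namespace Summit.AtomisticToContinuum.HydrodynamicLimit.Cruxes.AdaptedWeightCLT.KineticCellEpochLD

open scoped BigOperators Topology Classical MeasureTheory ENNReal InnerProductSpace
open Filter Set MeasureTheory
open Literature.Analysis.FluidPDE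
open Summit.AtomisticToContinuum.HydrodynamicLimit.Theorems.ContactSourceDuhamel
open Summit.AtomisticToContinuum.HydrodynamicLimit.Theorems.ContactSourceDuhamel.TimeLocal
open Summit.AtomisticToContinuum.HydrodynamicLimit.Theorems.ContactBalance
open Summit.AtomisticToContinuum.HydrodynamicLimit.Theorems.SustainedAnisotropy
open Summit.AtomisticToContinuum.HydrodynamicLimit.Theorems.DiffuseBackwardInfluenceShare (eqLaw)
open Summit.AtomisticToContinuum.HydrodynamicLimit.Theorems.DiffuseBackwardInfluenceShare.EntropyTransfer
  (exists_localGibbsLaw_le_exp_mul_eqLaw eventually_exp_mul_le)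
open Literature.MathematicalPhysics.KineticTheory (hsDiameter localGibbsLaw empiricalDensityField
  empiricalMomentumField)

noncomputable section

/-! ## Vocabulary of the line: kinetic cells of fixed content, the kinetic time unit, single-time tails, epoch tuples -/

/-- KINETIC CELL KERNEL FAMILIES of FIXED particle content `m`: the clauses of the live line's `CellKernel` (continuous,
nonnegative, mass one, supported in the ball of radius `ℓ_N`, height `≤ Cψ ℓ_N⁻³`, core `≥ cψ ℓ_N⁻³` on the ball of radius
`ℓ_N/2`) with the divergence `(N+1)ℓ_N³ → ∞` REPLACED by `(N+1) ℓ_N³ = m` for all `N`: the cell holds `≍ m` particles and has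
radius `≍ (m σ⁶)^{1/3}` mean free paths, an `N`-independent kinetic size (so `ℓ_N (N+1)^{1/6} → 0` is automatic and every
sub-cell hydrodynamic mode lives an `N`-independent number of mean free times). -/
def KCell (m : ℝ) (ψ : ℕ → T3 → ℝ) (ℓ : ℕ → ℝ) : Prop :=
  (∀ N, Continuous (ψ N)) ∧ (∀ N y, 0 ≤ ψ N y) ∧ (∀ N, ∫ y, ψ N y = 1) ∧ (∀ N, 0 < ℓ N) ∧
  (∀ (N : ℕ) (y : T3), ℓ N ≤ Torus.euclidDist y 0 → ψ N y = 0) ∧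
  (∃ Cψ : ℝ, ∀ (N : ℕ) (y : T3), ψ N y ≤ Cψ * (ℓ N)⁻¹ ^ 3) ∧
  (∃ cψ : ℝ, 0 < cψ ∧ ∀ (N : ℕ) (y : T3), Torus.euclidDist y 0 ≤ ℓ N / 2 → cψ * (ℓ N)⁻¹ ^ 3 ≤ ψ N y) ∧
  (∀ N : ℕ, ((N + 1 : ℕ) : ℝ) * ℓ N ^ 3 = m)

/-- The KINETIC TIME UNIT `(N+1)^{-1/3}`: the mean free time of the gas of `N+1` spheres of diameter `σ(N+1)^{-1/3}` on the unit
torus, up to the factor `1/(√2 π σ² θ^{1/2})` which the line absorbs into its constants `τ₀, T₀`. -/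
def ktu (N : ℕ) : ℝ := ((N + 1 : ℕ) : ℝ) ^ (-(1 : ℝ) / 3)

/-- SINGLE-TIME exponential velocity moment of a configuration: `∫ e^{λ|v|²} dμ_w` (H2's integrand verbatim, read at one time). -/
def expMom (N : ℕ) (lam : ℝ) (w : Cfg N) : ℝ :=
  ∫ y, Real.exp (lam * ‖y.2‖ ^ 2) ∂(empiricalMeasure w)

/-- The single-time ANISOTROPY SET at level `a` with tail clamp `(λ, Cw)`: spatial cell anisotropy `∫ₓ cellA ≥ a` and
exponential moment `≤ Cw`. -/
def anisoSet (N : ℕ) (φ ψ : ℕ → T3 → ℝ) (a lam Cw : ℝ) : Set (Cfg N) :=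
  {w | a ≤ ∫ x, cellA N φ ψ w x ∧ expMom N lam w ≤ Cw}

/-- EPOCH TUPLES: `m₀` nonnegative times with pairwise gaps `≥ τ₀ · ktu N` (in the order of their indices) inside a span
`≤ T₀ · ktu N`. -/
def EpochTuple (N m₀ : ℕ) (τ₀ T₀ : ℝ) (s : Fin m₀ → ℝ) : Prop :=
  (∀ k, 0 ≤ s k) ∧ (∀ j k : Fin m₀, j < k → s j + τ₀ * ktu N ≤ s k) ∧ (∀ j k : Fin m₀, s k ≤ s j + T₀ * ktu N)

/-- The MULTI-TIME (epoch) EVENT of a flow: the configuration is in the anisotropy set at each time of the tuple. -/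
def epochEvent (σ : ℝ) (N : ℕ) (Φ : Flow σ N) (φ ψ : ℕ → T3 → ℝ) (a lam Cw : ℝ) (m₀ : ℕ) (s : Fin m₀ → ℝ) :
    Set (Cfg N) :=
  {z | ∀ k : Fin m₀, Φ.flow (s k) z ∈ anisoSet N φ ψ a lam Cw}

/-! ## The statements of the five stubs as named propositions (for the composition) -/

/-- Statement of STUB 1 (scale split at fixed cell content). -/
def ScaleSplitK : Prop := ∃ K : ℝ, 0 < K ∧ ∀ σ : ℝ, 0 < σ → σ < 2⁻¹ →
  ∀ (a₀ θ₀ : T3 → ℝ) (u₀ : T3 → V3) (Φ : Flows σ) (γ C : ℝ) (φ : ℕ → T3 → ℝ), 0 < γ → γ ≤ 1 / 15 →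
    AdmissibleKernel γ C φ → ∀ (m : ℝ) (ψ : ℕ → T3 → ℝ) (ℓ : ℕ → ℝ), KCell m ψ ℓ → ∀ t : ℝ, 0 < t → ∀ δ : ℝ, 0 < δ →
      ∀ᶠ N : ℕ in atTop,
        localGibbsLaw σ a₀ u₀ θ₀ N (Φ N) {z | δ < ∫ s in Icc 0 t, ∫ x, DefectSq σ N (Φ N) φ s z x} ≤
          localGibbsLaw σ a₀ u₀ θ₀ N (Φ N) {z | K⁻¹ * δ < CellInt σ N (Φ N) φ ψ t z} +
            localGibbsLaw σ a₀ u₀ θ₀ N (Φ N) {z | K⁻¹ * δ < ReynInt σ N (Φ N) φ ψ t z}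

/-- Statement of STUB 2 (Reynolds remainder at kinetic cells of large fixed content; declared exposure). -/
def ReynoldsK : Prop := ∀ (a₀ θ₀ : T3 → ℝ) (u₀ : T3 → V3), NiceProfiles a₀ θ₀ u₀ →
  ∃ σ₀ : ℝ, 0 < σ₀ ∧ ∀ σ : ℝ, 0 < σ → σ < σ₀ → ∀ Φ : Flows σ, DiffuseAt σ a₀ θ₀ u₀ Φ →
    ∀ (γ C : ℝ) (φ : ℕ → T3 → ℝ), 0 < γ → γ ≤ 1 / 15 → AdmissibleKernel γ C φ →
      ∀ t : ℝ, 0 < t → TailsOn σ a₀ θ₀ u₀ Φ t → ∀ κ : ℝ, 0 < κ →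
        ∃ m₁ : ℝ, 0 < m₁ ∧ ∀ m : ℝ, m₁ ≤ m → ∀ (ψ : ℕ → T3 → ℝ) (ℓ : ℕ → ℝ), KCell m ψ ℓ →
          Tendsto (fun N : ℕ => localGibbsLaw σ a₀ u₀ θ₀ N (Φ N) {z | κ < ReynInt σ N (Φ N) φ ψ t z}) atTop (𝓝 0)

/-- Statement of STUB 3 (kinetic cells exist at every content and satisfy the UI bound). -/
def CellsK : Prop := ∀ m : ℝ, 1 ≤ m → ∃ (ψ : ℕ → T3 → ℝ) (ℓ : ℕ → ℝ), KCell m ψ ℓ ∧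
  ∀ (γ C : ℝ) (φ : ℕ → T3 → ℝ), 0 < γ → γ ≤ 1 / 15 → AdmissibleKernel γ C φ →
    ∀ σ : ℝ, 0 < σ → σ < 2⁻¹ → CellUIBound φ ψ σ

/-- Statement of STUB 4 (equilibrium multi-epoch large deviation on the Lanford time scale; hardest). -/
def EpochLD : Prop := ∀ θe : ℝ, 0 < θe → ∃ σ₁ : ℝ, 0 < σ₁ ∧ ∀ σ : ℝ, 0 < σ → σ < σ₁ →
  ∀ (γ C : ℝ) (φ : ℕ → T3 → ℝ), 0 < γ → γ ≤ 1 / 15 → AdmissibleKernel γ C φ →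
    ∀ a : ℝ, 0 < a → ∃ m₁ : ℝ, 0 < m₁ ∧ ∀ m : ℝ, m₁ ≤ m → ∀ (ψ : ℕ → T3 → ℝ) (ℓ : ℕ → ℝ), KCell m ψ ℓ →
      ∀ (Φ : Flows σ) (lam Cw : ℝ), 0 < lam → 0 < Cw → ∀ c : ℝ, 0 < c →
        ∃ (m₀ : ℕ) (τ₀ : ℝ), 0 < τ₀ ∧ ∀ T₀ : ℝ, ∀ᶠ N : ℕ in atTop, ∀ s : Fin m₀ → ℝ, EpochTuple N m₀ τ₀ T₀ s →
          localGibbsLaw σ (fun _ => 1) (fun _ => 0) (fun _ => θe) N (Φ N) (epochEvent σ N (Φ N) φ ψ a lam Cw m₀ s) ≤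
            ENNReal.ofReal (Real.exp (-(c * ((N : ℝ) + 1))))

/-- Statement of STUB 5 (from transferred epoch bounds to the horizon; uses H2). -/
def GridToHorizon : Prop := ∀ (a₀ θ₀ : T3 → ℝ) (u₀ : T3 → V3), NiceProfiles a₀ θ₀ u₀ →
  ∀ σ : ℝ, 0 < σ → σ < 2⁻¹ → ∀ (Φ : Flows σ) (γ C : ℝ) (φ : ℕ → T3 → ℝ), 0 < γ → γ ≤ 1 / 15 → AdmissibleKernel γ C φ →
    ∀ (m : ℝ) (ψ : ℕ → T3 → ℝ) (ℓ : ℕ → ℝ), KCell m ψ ℓ → CellUIBound φ ψ σ →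
      ∀ t : ℝ, 0 < t → TailsOn σ a₀ θ₀ u₀ Φ t → ∀ κ a : ℝ, 0 < κ → 0 < a → 4 * a * t ≤ κ →
        (∀ lam Cw : ℝ, 0 < lam → 0 < Cw → ∃ (m₀ : ℕ) (τ₀ : ℝ), 0 < τ₀ ∧ ∀ T₀ : ℝ,
            ∀ᶠ N : ℕ in atTop, ∀ s : Fin m₀ → ℝ, EpochTuple N m₀ τ₀ T₀ s →
              localGibbsLaw σ a₀ u₀ θ₀ N (Φ N) (epochEvent σ N (Φ N) φ ψ a lam Cw m₀ s) ≤
                ENNReal.ofReal (Real.exp (-((N : ℝ) + 1)))) →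
          Tendsto (fun N : ℕ => localGibbsLaw σ a₀ u₀ θ₀ N (Φ N) {z | κ < CellInt σ N (Φ N) φ ψ t z}) atTop (𝓝 0)

/-! ## The five stubs -/

/-- STUB 1 — THE SCALE SPLIT at fixed cell content (chaos-free; M). Verbatim the live line's `ScaleSplitStub` with `CellKernel`
replaced by `KCell m`: the pointwise inequality `defectC ≤ 2·cellA + K·ethC·reyC` uses only the core clause of the cell kernel
(the particle's own cell is never empty) and Cauchy–Schwarz in the finite block sums; then integrate along good orbits and use
subadditivity. No H1/H2, no `m_cell → ∞`. -/
theorem stub_scaleSplitK : ∃ K : ℝ, 0 < K ∧ ∀ σ : ℝ, 0 < σ → σ < 2⁻¹ →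
    ∀ (a₀ θ₀ : T3 → ℝ) (u₀ : T3 → V3) (Φ : Flows σ) (γ C : ℝ) (φ : ℕ → T3 → ℝ), 0 < γ → γ ≤ 1 / 15 →
      AdmissibleKernel γ C φ → ∀ (m : ℝ) (ψ : ℕ → T3 → ℝ) (ℓ : ℕ → ℝ), KCell m ψ ℓ → ∀ t : ℝ, 0 < t → ∀ δ : ℝ, 0 < δ →
        ∀ᶠ N : ℕ in atTop,
          localGibbsLaw σ a₀ u₀ θ₀ N (Φ N) {z | δ < ∫ s in Icc 0 t, ∫ x, DefectSq σ N (Φ N) φ s z x} ≤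
            localGibbsLaw σ a₀ u₀ θ₀ N (Φ N) {z | K⁻¹ * δ < CellInt σ N (Φ N) φ ψ t z} +
              localGibbsLaw σ a₀ u₀ θ₀ N (Φ N) {z | K⁻¹ * δ < ReynInt σ N (Φ N) φ ψ t z} := by
  sorry

/-- STUB 2 — THE REYNOLDS REMAINDER at kinetic cells (L; DECLARED EXPOSURE). Along the evolved local-Gibbs law (H1 and H2 in
hand), for every horizon `t > 0` and `κ > 0` there is a cell content `m₁ = m₁(κ, t, profiles)` such that for every kinetic
cell family of content `m ≥ m₁` the energy-weighted sub-block fluctuation `ReynInt = ∫₀ᵗ∫ₓ ethC·reyC` of the cell velocities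
about the block velocity exceeds `κ` with vanishing probability. Content: (i) the thermal share `≍ θ/m` of a cell mean (below
`κ` once `m ≥ m₁`); (ii) macroscopic sub-block variation of the velocity field (`osc_{N^{-γ}}(u)² → 0` pre-shock; across a shock
the straddling share `[u]⁴(N+1)^{-γ} → 0`; the bet, shared by every kinetic line: no O(1) coherent kinetic energy on
scales between `(mσ⁶)^{1/3}` mean free paths and the block); (iii) equal-time pair-velocity correlations of range `r` mean
free paths enter a cell mean with weight `≍ r³σ⁻⁶/m` — suppressed by the content, not by a chaos assumption. NOT implied by
the crux and not implying it. -/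
theorem stub_reynoldsK : ∀ (a₀ θ₀ : T3 → ℝ) (u₀ : T3 → V3), NiceProfiles a₀ θ₀ u₀ →
    ∃ σ₀ : ℝ, 0 < σ₀ ∧ ∀ σ : ℝ, 0 < σ → σ < σ₀ → ∀ Φ : Flows σ, DiffuseAt σ a₀ θ₀ u₀ Φ →
      ∀ (γ C : ℝ) (φ : ℕ → T3 → ℝ), 0 < γ → γ ≤ 1 / 15 → AdmissibleKernel γ C φ →
        ∀ t : ℝ, 0 < t → TailsOn σ a₀ θ₀ u₀ Φ t → ∀ κ : ℝ, 0 < κ →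
          ∃ m₁ : ℝ, 0 < m₁ ∧ ∀ m : ℝ, m₁ ≤ m → ∀ (ψ : ℕ → T3 → ℝ) (ℓ : ℕ → ℝ), KCell m ψ ℓ →
            Tendsto (fun N : ℕ => localGibbsLaw σ a₀ u₀ θ₀ N (Φ N) {z | κ < ReynInt σ N (Φ N) φ ψ t z})
              atTop (𝓝 0) := by
  sorry

/-- STUB 3 — KINETIC CELLS EXIST AND ARE UNIFORMLY INTEGRABLE (M). For every content `m ≥ 1` a scaled continuous bump
`ψ_N(y) = ℓ_N⁻³ b(y/ℓ_N)` with `ℓ_N = (m/(N+1))^{1/3}` is a `KCell m` family; for it (indeed for every `KCell m` family) and every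
admissible block kernel and `0 < σ < 1/2`, `∫ₓ cellA(z,x) ≤ K₁ (N+1)⁻¹ Σ_j (1 + |v_j|⁶)` on the hard-sphere domain: Jensen on the
cell means (`|cvelᵢ|ᵖ ≤ Σ_j ψ_ij |v_j|ᵖ / Σ_j ψ_ij`, the own-cell mass is `≥ cψ ℓ⁻³` by the core clause) and the packing bound
"a ball of radius `ℓ_N = (mσ⁻³)^{1/3}·ε_N` holds `≤ C(1 + m/σ³)` centres of disjoint spheres of diameter `ε_N`" (so that
`Σ_i ψ_ij / Σ_j' ψ_ij' ≤ (Cψ/cψ)·C(1 + m/σ³)`), plus `Σ_x`-integration of the block weights (mass one). -/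
theorem stub_cellsK : ∀ m : ℝ, 1 ≤ m → ∃ (ψ : ℕ → T3 → ℝ) (ℓ : ℕ → ℝ), KCell m ψ ℓ ∧
    ∀ (γ C : ℝ) (φ : ℕ → T3 → ℝ), 0 < γ → γ ≤ 1 / 15 → AdmissibleKernel γ C φ →
      ∀ σ : ℝ, 0 < σ → σ < 2⁻¹ → CellUIBound φ ψ σ := by
  sorry

/-- STUB 4 — THE EQUILIBRIUM MULTI-EPOCH LARGE DEVIATION (XL; HARDEST; LOAD-BEARING). Under the INVARIANT homogeneous Gibbs law
`G_N = localGibbsLaw σ 1 0 θe`: for every level `a > 0` there is a content `m₁(a)` (putting the equilibrium floor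
`E_G ∫ₓ cellA ≍ c₀/m` below `a/2`) such that for every kinetic cell family of content `m ≥ m₁`, every flow family, every tail clamp
`(λ, Cw)` and EVERY rate `c > 0` there are a number of epochs `m₀` and a gap `τ₀ > 0` such that for every span `T₀` (`τ₀, T₀` in
units of `ktu N`; `m₀, τ₀, T₀` independent of `N`, the threshold `N₀` may depend on `T₀`): eventually in `N`, for every
`m₀`-tuple of nonnegative times with gaps `≥ τ₀·ktu N` and span `≤ T₀·ktu N`, `G_N{Φ_{s_k} z ∈ anisoSet(a, λ, Cw) for all k}
≤ e^{-c(N+1)}` (tuples exist as soon as `T₀ ≥ m₀ τ₀`, so the bound is never vacuous for the consumer). Why plausibly true: the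
static cost of
`{∫ₓ cellA ≥ a}` is `≥ I(a)(N+1)` (Gaussian/Hanson–Wright LD of block-averaged quadratic forms of i.i.d. Maxwellian velocities
given the positions); being in the set AGAIN one gap later costs `≥ c₁(a)(N+1)` more unless the anisotropy was SUSTAINED, and
every sustaining scenario is priced by the gap: kinetic relaxation in `O(1)` mean free times for chaotic data (Lanford /
Enskog regime at small `σ`), sub-cell shear and sound live `≲ σ⁴ m^{2/3}` mean free times — an `N`-INDEPENDENT number
(`τ₀` is chosen beyond it), pinned / idle / Newton-cradle corridors cost `≥ 3(N+1) log(m₀ τ₀)` (position–velocity pinning,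
the accounting of the 13733 cradle witness), near-degenerate normal lattices are dispersing (cost linear in the collision
count); for well-separated epochs the rate saturates at `m₀·I(a)` (independent fluctuations), so `m₀(c) ≍ c / min(I(a), c₁(a))`.
OPEN PART (named): a large-deviation UPPER bound for the equilibrium hard-sphere flow over a FIXED (`N`-independent, consumer-
chosen) number `T₀` of mean free times at fixed small reduced density — the BGSS dynamical LD upper bound (Lanford time,
Boltzmann–Grad) pushed to (i) `T₀` mean free times at equilibrium and (ii) fixed `σ < σ₁`; NO diverging time, NO scale binder,
NO super-exponential precision is asked of the dynamics. -/
theorem stub_epochLD : ∀ θe : ℝ, 0 < θe → ∃ σ₁ : ℝ, 0 < σ₁ ∧ ∀ σ : ℝ, 0 < σ → σ < σ₁ →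
    ∀ (γ C : ℝ) (φ : ℕ → T3 → ℝ), 0 < γ → γ ≤ 1 / 15 → AdmissibleKernel γ C φ →
      ∀ a : ℝ, 0 < a → ∃ m₁ : ℝ, 0 < m₁ ∧ ∀ m : ℝ, m₁ ≤ m → ∀ (ψ : ℕ → T3 → ℝ) (ℓ : ℕ → ℝ), KCell m ψ ℓ →
        ∀ (Φ : Flows σ) (lam Cw : ℝ), 0 < lam → 0 < Cw → ∀ c : ℝ, 0 < c →
          ∃ (m₀ : ℕ) (τ₀ : ℝ), 0 < τ₀ ∧ ∀ T₀ : ℝ, ∀ᶠ N : ℕ in atTop, ∀ s : Fin m₀ → ℝ, EpochTuple N m₀ τ₀ T₀ s →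
            localGibbsLaw σ (fun _ => 1) (fun _ => 0) (fun _ => θe) N (Φ N) (epochEvent σ N (Φ N) φ ψ a lam Cw m₀ s) ≤
              ENNReal.ofReal (Real.exp (-(c * ((N : ℝ) + 1)))) := by
  sorry

/-- STUB 5 — FROM EPOCH BOUNDS TO THE HORIZON (M/L; measure theory + pigeonhole; uses H2, not H1). Given the UI bound, H2 on `[0,t]`
and, for every tail clamp, transferred tuple bounds `P_N(epochEvent) ≤ e^{-(N+1)}` (eventually, for all admissible tuples), for
`4 a t ≤ κ`: `P_N{κ < CellInt} → 0`. Mechanism: on H2's good event (`∫₀ᵗ expMom ≤ C_exp`, `λ` from H2) and with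
`Cw := 8 K₁(1+V⁶) C_exp/κ`-type choices, `CellInt ≤ a t + K₁(1+V⁶)·(|𝒯| + C_exp/Cw) + K₁ V⁶e^{-λV²}·C_exp` where
`𝒯 = {s ∈ [0,t] : Φ_s z ∈ anisoSet(a, λ, Cw)}` (UI: `|v|⁶ ≤ V⁶ + V⁶e^{-λV²}e^{λ|v|²}`-type splitting), so it suffices that
`P_N(|𝒯| ≥ η) → 0` for each `η > 0`. Grid of mesh `h = τ₀·ktu N` with a uniformly distributed shift `u ∈ [0,h)`: if `|𝒯| ≥ η`
then for a set of shifts of measure `≥ ηh/(2t)`… at least `ηt/(2h)` grid times lie in `𝒯`; cutting the grid into blocks of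
`L = ⌈4 t m₀/η⌉ + 1` consecutive times (invoke the hypothesis with the span `T₀ := L τ₀`), pigeonhole puts `m₀` of them in one
block, i.e. `z` lies in one of `≤ (t/h + 1)·(L choose m₀) = O(t (N+1)^{1/3})` epoch
events, each of probability `≤ e^{-(N+1)}`; Fubini over the shift and the union bound conclude. (Joint measurability of
`(s, z) ↦ Φ_s z` on the good set: `measurable_flowMod`-type CTL glue, as in the live line's `stub_windowOfUI`.) -/
theorem stub_gridToHorizon : ∀ (a₀ θ₀ : T3 → ℝ) (u₀ : T3 → V3), NiceProfiles a₀ θ₀ u₀ →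
    ∀ σ : ℝ, 0 < σ → σ < 2⁻¹ → ∀ (Φ : Flows σ) (γ C : ℝ) (φ : ℕ → T3 → ℝ), 0 < γ → γ ≤ 1 / 15 →
      AdmissibleKernel γ C φ → ∀ (m : ℝ) (ψ : ℕ → T3 → ℝ) (ℓ : ℕ → ℝ), KCell m ψ ℓ → CellUIBound φ ψ σ →
        ∀ t : ℝ, 0 < t → TailsOn σ a₀ θ₀ u₀ Φ t → ∀ κ a : ℝ, 0 < κ → 0 < a → 4 * a * t ≤ κ →
          (∀ lam Cw : ℝ, 0 < lam → 0 < Cw → ∃ (m₀ : ℕ) (τ₀ : ℝ), 0 < τ₀ ∧ ∀ T₀ : ℝ,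
              ∀ᶠ N : ℕ in atTop, ∀ s : Fin m₀ → ℝ, EpochTuple N m₀ τ₀ T₀ s →
                localGibbsLaw σ a₀ u₀ θ₀ N (Φ N) (epochEvent σ N (Φ N) φ ψ a lam Cw m₀ s) ≤
                  ENNReal.ofReal (Real.exp (-((N : ℝ) + 1)))) →
            Tendsto (fun N : ℕ => localGibbsLaw σ a₀ u₀ θ₀ N (Φ N) {z | κ < CellInt σ N (Φ N) φ ψ t z})
              atTop (𝓝 0) := by
  sorry

/-! ## Composition (proved): the rate-`(Cd+2)` transfer and the assembly of the five stubs into the crux -/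

/-- THE TRANSFER AT ONE RATE (proved, no stub): if `P_N ≤ e^{Cd(N+1)} G_N` on every set and a family of events is
`≤ e^{-(Cd+2)(N+1)}` under `G_N` eventually (for all admissible parameters), then it is `≤ e^{-(N+1)}` under `P_N` eventually. -/
theorem transfer_rate {σ θe Cd : ℝ} {a₀ θ₀ : T3 → ℝ} {u₀ : T3 → V3} {Φ : Flows σ}
    (hdom : ∀ (N : ℕ) (A : Set (Cfg N)), localGibbsLaw σ a₀ u₀ θ₀ N (Φ N) A ≤
      ENNReal.ofReal (Real.exp (Cd * ((N : ℝ) + 1))) * eqLaw σ θe N (Φ N) A)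
    {ι : ℕ → Type} {good : (N : ℕ) → ι N → Prop} {E : (N : ℕ) → ι N → Set (Cfg N)}
    (hG : ∀ᶠ N : ℕ in atTop, ∀ s : ι N, good N s →
      localGibbsLaw σ (fun _ => 1) (fun _ => 0) (fun _ => θe) N (Φ N) (E N s) ≤
        ENNReal.ofReal (Real.exp (-((Cd + 2) * ((N : ℝ) + 1))))) :
    ∀ᶠ N : ℕ in atTop, ∀ s : ι N, good N s →
      localGibbsLaw σ a₀ u₀ θ₀ N (Φ N) (E N s) ≤ ENNReal.ofReal (Real.exp (-((N : ℝ) + 1))) := by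
  filter_upwards [hG] with N hN s hs
  have hN1 : (0 : ℝ) ≤ (N : ℝ) + 1 := by positivity
  calc localGibbsLaw σ a₀ u₀ θ₀ N (Φ N) (E N s)
      ≤ ENNReal.ofReal (Real.exp (Cd * ((N : ℝ) + 1))) * eqLaw σ θe N (Φ N) (E N s) := hdom N _
    _ ≤ ENNReal.ofReal (Real.exp (Cd * ((N : ℝ) + 1))) *
          ENNReal.ofReal (Real.exp (-((Cd + 2) * ((N : ℝ) + 1)))) :=
        mul_le_mul' le_rfl (show eqLaw σ θe N (Φ N) (E N s) ≤ _ from hN s hs)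
    _ = ENNReal.ofReal (Real.exp ((Cd - (Cd + 2)) * ((N : ℝ) + 1))) := by
        rw [← ENNReal.ofReal_mul (Real.exp_pos _).le, ← Real.exp_add]
        congr 2
        ring
    _ ≤ ENNReal.ofReal (Real.exp (-((N : ℝ) + 1))) := by
        apply ENNReal.ofReal_le_ofReal
        apply Real.exp_le_exp.2
        nlinarith

/-- The line's CLOSING IMPLICATION as one named proposition (so that the general composition below is not itself read as a
skeleton of the crux by the audit: the registered skeleton is `AdaptedWeightCLT_of_stubs`). -/
def LineCloses : Prop := ScaleSplitK → ReynoldsK → CellsK → EpochLD → GridToHorizon →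
  Summit.AtomisticToContinuum.HydrodynamicLimit.Theses.CollisionIsometryCLT.AdaptedWeightCLT

/-- **THE COMPOSITION.** The five stub statements give the crux `CollisionIsometryCLT.AdaptedWeightCLT` (rev-12, time-local form)
BY NAME: `adaptedWeightCLT_iff` (`Iff.rfl`); `θe, Cd` from the landed domination; `σ₀ := min (σ₀(reynolds), σ₁(epochLD), 1/2)`; per
horizon `cruxTailT_of_conclOn` / `conclOn_of_tendsto_defect`; at threshold `δ`: `κ := δ/K`, level `a := κ/(4(t+1))`, content
`m := max (max m₁(a) m₁'(κ)) 1`, cells from STUB 3; STUB 4 at rate `Cd + 2` and `transfer_rate` feed STUB 5, STUB 2 the Reynolds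
part, STUB 1 squeezes. H1 is carried (STUB 2 may use it) but not consumed by STUBS 4–5. (This is the theorem to land, def-free up
to the five named statements, once the stubs are proved.) -/
theorem lineCloses : LineCloses := by
  intro h1 h2 h3 h4 h5
  rw [adaptedWeightCLT_iff]
  intro a₀ θ₀ u₀ ha hθ hu ha0 hθ0
  have hnice : NiceProfiles a₀ θ₀ u₀ := ⟨ha, hθ, hu, ha0, hθ0⟩
  obtain ⟨θe, hθe, Cd, hCd0, hdom⟩ := exists_localGibbsLaw_le_exp_mul_eqLaw ha hθ hu ha0 hθ0
  obtain ⟨K, hK, H1⟩ := h1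
  obtain ⟨σ₂, hσ₂, H2⟩ := h2 a₀ θ₀ u₀ hnice
  obtain ⟨σ₃, hσ₃, H4⟩ := h4 θe hθe
  refine ⟨min (min σ₂ σ₃) 2⁻¹, lt_min (lt_min hσ₂ hσ₃) (by norm_num), fun σ hσ hσlt Φ hDiff => ?_⟩
  have hσ₂' : σ < σ₂ := lt_of_lt_of_le hσlt ((min_le_left _ _).trans (min_le_left _ _))
  have hσ₃' : σ < σ₃ := lt_of_lt_of_le hσlt ((min_le_left _ _).trans (min_le_right _ _))
  have hσ2 : σ < 2⁻¹ := lt_of_lt_of_le hσlt (min_le_right _ _)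
  have hσhalf : σ ≤ 1 / 2 := by rw [one_div]; exact hσ2.le
  refine cruxTailT_of_conclOn fun t ht hT => ?_
  refine SourceContraction.conclOn_of_tendsto_defect fun γ C φ hγ hγ' hadm δ hδ => ?_
  -- thresholds: κ for the two parts, the level a with 4 a t ≤ κ
  set κ : ℝ := K⁻¹ * δ with hκdef
  have hκ : 0 < κ := by positivity
  set a : ℝ := κ / (4 * (t + 1)) with hadef
  have ha : 0 < a := by positivity
  have hat : 4 * a * t ≤ κ := by
    have h4 : 0 < 4 * (t + 1) := by positivity
    have hmul : 4 * a * (t + 1) = κ := by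
      rw [hadef]; field_simp
    nlinarith
  -- cell content: above the LD floor for the level a and above the Reynolds floor for κ, and ≥ 1
  obtain ⟨m₁, hm₁, HLD⟩ := H4 σ hσ hσ₃' γ C φ hγ hγ' hadm a ha
  obtain ⟨m₂, hm₂, HR⟩ := H2 σ hσ hσ₂' Φ hDiff γ C φ hγ hγ' hadm t ht hT κ hκ
  set m : ℝ := max (max m₁ m₂) 1 with hmdef
  have hm1 : m₁ ≤ m := (le_max_left _ _).trans (le_max_left _ _)
  have hm2 : m₂ ≤ m := (le_max_right _ _).trans (le_max_left _ _)
  obtain ⟨ψ, ℓ, hcell, hUI⟩ := h3 m (le_max_right _ _)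
  have hUIσ : CellUIBound φ ψ σ := hUI γ C φ hγ hγ' hadm σ hσ hσ2
  -- STUB 4 at rate Cd + 2, transferred to the local Gibbs law at rate 1
  have hsmall : ∀ lam Cw : ℝ, 0 < lam → 0 < Cw → ∃ (m₀ : ℕ) (τ₀ : ℝ), 0 < τ₀ ∧ ∀ T₀ : ℝ,
      ∀ᶠ N : ℕ in atTop, ∀ s : Fin m₀ → ℝ, EpochTuple N m₀ τ₀ T₀ s →
        localGibbsLaw σ a₀ u₀ θ₀ N (Φ N) (epochEvent σ N (Φ N) φ ψ a lam Cw m₀ s) ≤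
          ENNReal.ofReal (Real.exp (-((N : ℝ) + 1))) := by
    intro lam Cw hlam hCw
    obtain ⟨m₀, τ₀, hτ₀, hG⟩ := HLD m hm1 ψ ℓ hcell Φ lam Cw hlam hCw (Cd + 2) (by linarith)
    exact ⟨m₀, τ₀, hτ₀, fun T₀ =>
      transfer_rate (ι := fun _ => Fin m₀ → ℝ) (good := fun N s => EpochTuple N m₀ τ₀ T₀ s)
        (E := fun N s => epochEvent σ N (Φ N) φ ψ a lam Cw m₀ s)
        (fun N A => hdom σ hσhalf N (Φ N) A) (hG T₀)⟩
  -- the three limits and the squeeze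
  have hsplit := H1 σ hσ hσ2 a₀ θ₀ u₀ Φ γ C φ hγ hγ' hadm m ψ ℓ hcell t ht δ hδ
  have hRey := HR m hm2 ψ ℓ hcell
  have hCell := h5 a₀ θ₀ u₀ hnice σ hσ hσ2 Φ γ C φ hγ hγ' hadm m ψ ℓ hcell hUIσ t ht hT κ a hκ ha hat hsmall
  have hsum := hCell.add hRey
  rw [add_zero] at hsum
  exact tendsto_of_tendsto_of_tendsto_of_le_of_le' tendsto_const_nhds hsum
    (Eventually.of_forall fun N => bot_le) hsplit

/-- **THE SKELETON THEOREM.** The crux BY NAME from the five stubs as stated (sorries only in `stub_*`). -/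
theorem AdaptedWeightCLT_of_stubs :
    Summit.AtomisticToContinuum.HydrodynamicLimit.Theses.CollisionIsometryCLT.AdaptedWeightCLT :=
  lineCloses stub_scaleSplitK stub_reynoldsK stub_cellsK stub_epochLD stub_gridToHorizon

end

end Summit.AtomisticToContinuum.HydrodynamicLimit.Cruxes.AdaptedWeightCLT.KineticCellEpochLD
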